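import Summits.AtomisticToContinuum.HydrodynamicLimit.Theses.LambertianContactSwap
import Summits.AtomisticToContinuum.HydrodynamicLimit.Theses.TwoClocks
import Summits.AtomisticToContinuum.HydrodynamicLimit.Theorems.LambertianContactSwapSwapGapOfHydrodynamicLimit
import Summits.AtomisticToContinuum.HydrodynamicLimit.Theorems.LambertianContactSwapLocalGibbsProbability
import Summits.AtomisticToContinuum.HydrodynamicLimit.Theorems.TwoClocksEntropyToHydro
import HarnessLib

/-!
# `SwapGap` (stmt-AtomisticToContinuum-11850) from the EXISTING items `RelEntropyVanishing` (stmt-0766) and `LambertianEuler` (stmt-11854)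

Helper file (`--supports stmt-AtomisticToContinuum-11850`) of line `Sketch` for the crux
`Summit.AtomisticToContinuum.HydrodynamicLimit.Theses.LambertianContactSwap.SwapGap` (lead c4, cycle 5, skeleton v9 §8b).
The shared relative-entropy target `TwoClocks.RelEntropyVanishing` (stmt-AtomisticToContinuum-0766, Yau's form of the conjunct for the
DETERMINISTIC gas: `KL(lawAt Φ_N P_N t ‖ reference local Gibbs law at time t)/(N+1) → 0` with an exponentially concentrating reference)
gives the conjunct by the landed glue `entropyToHydro_proof` (stmt-0769), and the conjunct together with the route's sibling crux
`LambertianEuler` (stmt-11854) gives `SwapGap` by the landed `swapGap_of_hydrodynamicLimit` (p106428) fed with `localGibbsProbability_proof`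
(stmt-12098).  So, modulo the route's own second crux 11854 (wanted anyway: `closes : SwapGap → LambertianEuler → HydrodynamicLimit`), this
crux is dominated by the existing item 0766 — a second cross-route reduction next to `swapGap_of_randomFutureTransfer` (stmt-11851 ∧ 11852 ∧
11853, p126695).  Conditional result: the item stays open until its own signature is proved.
-/

namespace Summit.AtomisticToContinuum.HydrodynamicLimit.Theorems

open Summit.AtomisticToContinuum.HydrodynamicLimit.Theses
open Summit.AtomisticToContinuum.HydrodynamicLimit.Theses.LambertianContactSwap

/-- **`SwapGap` ⇐ stmt-0766 ∧ stmt-11854**: `RelEntropyVanishing` (Yau form of the conjunct, route TwoClocks' shared target) gives the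
conjunct (`entropyToHydro_proof`), and conjunct ∧ `LambertianEuler` give `SwapGap` (`swapGap_of_hydrodynamicLimit`, with the proved support
`localGibbsProbability_proof`). [cite: Yau1991, §2] -/
theorem swapGap_of_relEntropyVanishing_of_lambertianEuler (hRE : TwoClocks.RelEntropyVanishing) (hL : LambertianEuler) :
    SwapGap :=
  swapGap_of_hydrodynamicLimit localGibbsProbability_proof hL (entropyToHydro_proof hRE)

end Summit.AtomisticToContinuum.HydrodynamicLimit.Theorems
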